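import Summits.NavierStokesRegularity.NavierStokesRegularity.Theses.HodographBetchov

/-!
# Crux `HodographBetchov.FastClassSqueeze` — the min–max clause as a plane field

Helper file for the crux item stmt-NavierStokesRegularity-15832 (`FastClassSqueeze`, route
`HodographBetchov` of `NavierStokesRegularity`). The crux asks, along every classical Leray–Hopf
solution from a rapidly decaying datum, for a level `l > 0`, an exponent `q > 3/2` and a nonnegative
majorant `m(t,x)` which (min–max clause) bounds the quadratic form of `∇u(t,x)` on SOME 2-plane at
every fast point `|u(t,x)| > l`, with `∫₀ᵀ (∫_{|u|>l} m^q)^{2/(2q−3)} < ∞`.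

This file proves that the clause is exactly the choice of a PLANE FIELD, with the canonical majorant
the TRANSVERSE RAYLEIGH SUPREMUM: for a direction `n` (any vector, `0` allowed) and `A = ∇u(t,x)`,
`τ(A,n) := sup {⟪Aξ,ξ⟫ : ξ ⊥ n, ‖ξ‖ = 1}` (the top eigenvalue of the strain compressed to the plane
`n^⊥`; for `n = 0` it is the top eigenvalue of the strain). Precisely:

* `fastClassSqueeze_iff_planeFieldSqueeze` — **`FastClassSqueeze` ⇔ PLANE-FIELD SQUEEZE**: along
  every such solution there are a field `n : ℝ → ℝ³ → ℝ³`, `l > 0` and `q > 3/2` with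
  `∫₀ᵀ (∫_{|u(t)|>l} τ(∇u(t,x), n(t,x))^q dx)^{2/(2q−3)} dt < ∞` (negative part of `τ` dropped by
  `ENNReal.ofReal`). (⇐): any orthonormal pair in `n^⊥` (`exists_orthonormal_pair_perp`) realises the
  clause with `m = τ⁺` (`form_le_transverseSup_mul`); (⇒): the clause's plane at a fast point has a
  normal `n` (`exists_normal_of_orthonormal_pair`, `dim = 3`), and `τ(∇u,n) ≤ m`
  (`transverseSup_le`).
* corollaries = the transfer lemmas of the two remaining crux-ideate cards, now one-liners:
  `fastClassSqueeze_of_streamNormalSqueeze` (card `stream-normal-block`: `n = u`, the stream-normal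
  strain block `PSP`, `P = 1 − û⊗û`, whose top eigenvalue is `τ(∇u,u)`),
  `fastClassSqueeze_of_isotachSqueeze` (card `velocity-adapted-planes`, plane `Π_I`: `n = (∇u)ᵀu`,
  the isotach tangent plane) and `fastClassSqueeze_of_menuSqueeze` (same card, the MENU majorant
  `min(τ(∇u,u), τ(∇u,(∇u)ᵀu))`: a plane field may switch pointwise between the two planes).

Only linear algebra of `ℝ³` and monotonicity of the integrals enter; no property of the solution is
used except continuity of `u(t)` (measurability of the fast class) in (⇒).

References: R. A. Horn, C. R. Johnson, Matrix Analysis (2013), Thm. 4.2.6 (Courant–Fischer);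
E. Miller, Arch. Ration. Mech. Anal. 235 (2020), Thm. 1.1.
-/

noncomputable section

open Set MeasureTheory Filter Topology Function Module
open scoped ENNReal NNReal InnerProductSpace

-- the summit and its single sub-problem share the name (CONVENTIONS §1), as in every Theorems file
set_option linter.dupNamespace false

namespace Summit.NavierStokesRegularity.NavierStokesRegularity.Theorems.FastClassSqueeze.PlaneField

open Literature.Analysis Literature.Analysis.FluidPDE

/-! ## Linear algebra of `ℝ³`: planes, normals, the transverse Rayleigh supremum -/

/-- **In `ℝ³` every vector admits an orthonormal pair orthogonal to it** (for `n = 0` any orthonormal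
pair; for `n ≠ 0` an orthonormal basis of `(ℝ n)^⊥`, which has dimension `2`). [folklore] -/
theorem exists_orthonormal_pair_perp (n : EuclideanSpace ℝ (Fin 3)) :
    ∃ v w : EuclideanSpace ℝ (Fin 3),
      ‖v‖ = 1 ∧ ‖w‖ = 1 ∧ ⟪v, w⟫_ℝ = 0 ∧ ⟪v, n⟫_ℝ = 0 ∧ ⟪w, n⟫_ℝ = 0 := by
  set K : Submodule ℝ (EuclideanSpace ℝ (Fin 3)) := (ℝ ∙ n)ᗮ with hK
  have hdim : 2 ≤ finrank ℝ K := by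
    by_cases hn : n = 0
    · have htop : K = ⊤ := by
        rw [hK, hn]
        simp
      rw [htop, finrank_top, finrank_euclideanSpace_fin]
      norm_num
    · haveI : Fact (finrank ℝ (EuclideanSpace ℝ (Fin 3)) = 2 + 1) :=
        ⟨by rw [finrank_euclideanSpace_fin]⟩
      rw [hK, Submodule.finrank_orthogonal_span_singleton (n := 2) hn]
  set b := stdOrthonormalBasis ℝ K with hb
  have h0 : 0 < finrank ℝ K := by omega
  have h1 : 1 < finrank ℝ K := by omega
  set i0 : Fin (finrank ℝ K) := ⟨0, h0⟩
  set i1 : Fin (finrank ℝ K) := ⟨1, h1⟩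
  have hne : i0 ≠ i1 := by
    intro h
    have h' := congrArg Fin.val h
    simp [i0, i1] at h'
  refine ⟨(b i0 : EuclideanSpace ℝ (Fin 3)), (b i1 : EuclideanSpace ℝ (Fin 3)), ?_, ?_, ?_, ?_, ?_⟩
  · exact_mod_cast b.orthonormal.norm_eq_one i0
  · exact_mod_cast b.orthonormal.norm_eq_one i1
  · rw [← Submodule.coe_inner]; exact b.orthonormal.inner_eq_zero hne
  · have hm : (b i0 : EuclideanSpace ℝ (Fin 3)) ∈ (ℝ ∙ n)ᗮ := (b i0).2
    exact (Submodule.mem_orthogonal_singleton_iff_inner_left).1 hm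
  · have hm : (b i1 : EuclideanSpace ℝ (Fin 3)) ∈ (ℝ ∙ n)ᗮ := (b i1).2
    exact (Submodule.mem_orthogonal_singleton_iff_inner_left).1 hm

/-- The Rayleigh quotients `⟪Aξ, ξ⟫`, `‖ξ‖ = 1`, `ξ ⊥ n`, are bounded above (by `‖A‖`). [folklore] -/
theorem bddAbove_form_image (A : EuclideanSpace ℝ (Fin 3) →L[ℝ] EuclideanSpace ℝ (Fin 3))
    (n : EuclideanSpace ℝ (Fin 3)) :
    BddAbove ((fun ξ => ⟪A ξ, ξ⟫_ℝ) '' {ξ | ⟪ξ, n⟫_ℝ = 0 ∧ ‖ξ‖ = 1}) := by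
  refine ⟨‖A‖, ?_⟩
  rintro _ ⟨ξ, ⟨-, hξ⟩, rfl⟩
  calc ⟪A ξ, ξ⟫_ℝ ≤ ‖A ξ‖ * ‖ξ‖ := real_inner_le_norm _ _
    _ ≤ ‖A‖ * ‖ξ‖ * ‖ξ‖ := by gcongr; exact A.le_opNorm ξ
    _ = ‖A‖ := by rw [hξ]; ring

/-- `‖αv + βw‖² = α² + β²` for an orthonormal pair. [folklore] -/
theorem norm_sq_combo {v w : EuclideanSpace ℝ (Fin 3)} (hv : ‖v‖ = 1) (hw : ‖w‖ = 1)
    (hvw : ⟪v, w⟫_ℝ = 0) (α β : ℝ) :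
    ‖α • v + β • w‖ ^ 2 = α ^ 2 + β ^ 2 := by
  rw [norm_add_sq_real, norm_smul, norm_smul, hv, hw, inner_smul_left, inner_smul_right, hvw]
  simp only [Real.norm_eq_abs, mul_one, conj_trivial, mul_zero, add_zero]
  rw [sq_abs, sq_abs]

/-- **The plane form is bounded by the transverse Rayleigh supremum.** For an orthonormal pair
`v, w ⊥ n` and all `α, β`: `⟪A(αv + βw), αv + βw⟫ ≤ τ(A, n) (α² + β²)`,
`τ(A, n) = sup {⟪Aξ, ξ⟫ : ξ ⊥ n, ‖ξ‖ = 1}` (normalise `αv + βw`). [folklore] -/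
theorem form_le_transverseSup_mul (A : EuclideanSpace ℝ (Fin 3) →L[ℝ] EuclideanSpace ℝ (Fin 3))
    (n : EuclideanSpace ℝ (Fin 3)) {v w : EuclideanSpace ℝ (Fin 3)}
    (hv : ‖v‖ = 1) (hw : ‖w‖ = 1) (hvw : ⟪v, w⟫_ℝ = 0) (hvn : ⟪v, n⟫_ℝ = 0) (hwn : ⟪w, n⟫_ℝ = 0)
    (α β : ℝ) :
    ⟪A (α • v + β • w), α • v + β • w⟫_ℝ ≤
      sSup ((fun ξ => ⟪A ξ, ξ⟫_ℝ) '' {ξ | ⟪ξ, n⟫_ℝ = 0 ∧ ‖ξ‖ = 1}) * (α ^ 2 + β ^ 2) := by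
  set ξ : EuclideanSpace ℝ (Fin 3) := α • v + β • w with hξ
  have hnorm : ‖ξ‖ ^ 2 = α ^ 2 + β ^ 2 := norm_sq_combo hv hw hvw α β
  have hperp : ⟪ξ, n⟫_ℝ = 0 := by
    rw [hξ, inner_add_left, inner_smul_left, inner_smul_left, hvn, hwn]
    simp
  by_cases hz : ξ = 0
  · have hab : α ^ 2 + β ^ 2 = 0 := by rw [← hnorm, hz, norm_zero]; ring
    rw [hz, hab]
    simp
  · have hξpos : 0 < ‖ξ‖ := norm_pos_iff.2 hz
    set η : EuclideanSpace ℝ (Fin 3) := ‖ξ‖⁻¹ • ξ with hη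
    have hηn : ‖η‖ = 1 := by
      rw [hη, norm_smul, norm_inv, norm_norm, inv_mul_cancel₀ hξpos.ne']
    have hηperp : ⟪η, n⟫_ℝ = 0 := by
      rw [hη, inner_smul_left, hperp]; simp
    have hle : ⟪A η, η⟫_ℝ ≤ sSup ((fun ξ => ⟪A ξ, ξ⟫_ℝ) '' {ξ | ⟪ξ, n⟫_ℝ = 0 ∧ ‖ξ‖ = 1}) :=
      le_csSup (bddAbove_form_image A n) ⟨η, ⟨hηperp, hηn⟩, rfl⟩
    have hform : ⟪A ξ, ξ⟫_ℝ = ‖ξ‖ ^ 2 * ⟪A η, η⟫_ℝ := by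
      have hξη : ξ = ‖ξ‖ • η := by
        rw [hη, smul_smul, mul_inv_cancel₀ hξpos.ne', one_smul]
      conv_lhs => rw [hξη]
      rw [map_smul, inner_smul_left, inner_smul_right]
      simp only [conj_trivial]
      ring
    rw [hform, ← hnorm, mul_comm]
    exact mul_le_mul_of_nonneg_right hle (sq_nonneg _)

/-- **An orthonormal pair in `ℝ³` has a normal**: a vector `n` such that every vector orthogonal to
`n` lies in the plane of the pair (`n` = a unit vector of the line `(span{v, w})^⊥`). [folklore] -/
theorem exists_normal_of_orthonormal_pair {v w : EuclideanSpace ℝ (Fin 3)} (hv : ‖v‖ = 1)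
    (hw : ‖w‖ = 1) (hvw : ⟪v, w⟫_ℝ = 0) :
    ∃ n : EuclideanSpace ℝ (Fin 3), ⟪v, n⟫_ℝ = 0 ∧
      ∀ ξ : EuclideanSpace ℝ (Fin 3), ⟪ξ, n⟫_ℝ = 0 → ∃ α β : ℝ, ξ = α • v + β • w := by
  have hwv : ⟪w, v⟫_ℝ = 0 := (real_inner_comm v w).trans hvw
  have hon : Orthonormal ℝ ![v, w] := by
    rw [orthonormal_iff_ite]
    intro i j
    fin_cases i <;> fin_cases j <;> simp [hv, hw, hvw, hwv]
  set K : Submodule ℝ (EuclideanSpace ℝ (Fin 3)) := Submodule.span ℝ (Set.range ![v, w]) with hKdef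
  have hK : finrank ℝ K = 2 := by
    rw [hKdef, finrank_span_eq_card hon.linearIndependent]
    simp
  have hKo : finrank ℝ Kᗮ = 1 := by
    have h := Submodule.finrank_add_finrank_orthogonal K
    rw [hK, finrank_euclideanSpace_fin] at h
    omega
  set b := stdOrthonormalBasis ℝ Kᗮ with hb
  have h0 : 0 < finrank ℝ Kᗮ := by omega
  set n : EuclideanSpace ℝ (Fin 3) := (b ⟨0, h0⟩ : EuclideanSpace ℝ (Fin 3)) with hndef
  have hn1 : ‖n‖ = 1 := by exact_mod_cast b.orthonormal.norm_eq_one ⟨0, h0⟩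
  have hn0 : n ≠ 0 := by
    intro h; rw [h, norm_zero] at hn1; exact zero_ne_one hn1
  have hnK : n ∈ Kᗮ := (b ⟨0, h0⟩).2
  have hvK : v ∈ K := by
    rw [hKdef]
    exact Submodule.subset_span ⟨0, rfl⟩
  -- `Kᗮ = ℝ ∙ n`
  have hspan : (ℝ ∙ n) = Kᗮ := by
    refine Submodule.eq_of_le_of_finrank_eq ?_ ?_
    · exact (Submodule.span_singleton_le_iff_mem n Kᗮ).2 hnK
    · rw [finrank_span_singleton hn0, hKo]
  refine ⟨n, ?_, fun ξ hξ => ?_⟩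
  · -- `v ∈ K` and `n ∈ Kᗮ`
    exact (Submodule.mem_orthogonal K n).1 hnK v hvK
  -- `ξ ∈ Kᗮᗮ = K`
  have hξK : ξ ∈ K := by
    rw [← Submodule.orthogonal_orthogonal K, Submodule.mem_orthogonal]
    intro y hy
    rw [← hspan, Submodule.mem_span_singleton] at hy
    obtain ⟨c, rfl⟩ := hy
    rw [real_inner_smul_left, real_inner_comm, hξ, mul_zero]
  rw [hKdef, Submodule.mem_span_range_iff_exists_fun] at hξK
  obtain ⟨c, hc⟩ := hξK
  refine ⟨c 0, c 1, ?_⟩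
  rw [← hc, Fin.sum_univ_two]
  simp

/-- **With a normal, the transverse supremum is at most the plane bound.** If every vector
orthogonal to `n` lies in the plane of the orthonormal pair `v, w`, `v ⊥ n`, and the quadratic form
of `A` is `≤ m (α² + β²)` on that plane, then `τ(A, n) ≤ m`. [folklore] -/
theorem transverseSup_le {A : EuclideanSpace ℝ (Fin 3) →L[ℝ] EuclideanSpace ℝ (Fin 3)}
    {v w n : EuclideanSpace ℝ (Fin 3)} {m : ℝ} (hv : ‖v‖ = 1) (hw : ‖w‖ = 1)
    (hvw : ⟪v, w⟫_ℝ = 0) (hvn : ⟪v, n⟫_ℝ = 0)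
    (hn : ∀ ξ : EuclideanSpace ℝ (Fin 3), ⟪ξ, n⟫_ℝ = 0 → ∃ α β : ℝ, ξ = α • v + β • w)
    (hm : ∀ α β : ℝ, ⟪A (α • v + β • w), α • v + β • w⟫_ℝ ≤ m * (α ^ 2 + β ^ 2)) :
    sSup ((fun ξ => ⟪A ξ, ξ⟫_ℝ) '' {ξ | ⟪ξ, n⟫_ℝ = 0 ∧ ‖ξ‖ = 1}) ≤ m := by
  refine csSup_le ⟨_, ⟨v, ⟨hvn, hv⟩, rfl⟩⟩ ?_
  rintro _ ⟨ξ, ⟨hξn, hξ1⟩, rfl⟩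
  obtain ⟨α, β, rfl⟩ := hn ξ hξn
  have h1 : α ^ 2 + β ^ 2 = 1 := by rw [← norm_sq_combo hv hw hvw α β, hξ1]; norm_num
  have h := hm α β
  rwa [h1, mul_one] at h

/-! ## The crux as a plane-field squeeze -/

/-- **`FastClassSqueeze` ⇔ PLANE-FIELD SQUEEZE.** Crux `FastClassSqueeze` holds iff along every
classical solution of unforced Navier–Stokes on `ℝ³ × [0,T)` that is Leray–Hopf from a rapidly
decaying datum there are a direction field `n(t,x)` (any vectors, `0` allowed), a level `l > 0` and an
exponent `q > 3/2` such that the transverse Rayleigh supremum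
`τ(t,x) = sup {⟪∇u(t,x) ξ, ξ⟫ : ξ ⊥ n(t,x), ‖ξ‖ = 1}` (top eigenvalue of the strain compressed to the
plane `n(t,x)^⊥`) satisfies `∫₀ᵀ (∫_{|u(t)|>l} (τ⁺)^q dx)^{2/(2q−3)} dt < ∞`. (⇒) the clause's plane
at each fast point has a normal, off the fast class take `n = 0`; (⇐) any orthonormal pair in `n^⊥`
realises the clause with `m = τ⁺`. [cite: HornJohnson2013, Thm 4.2.6] -/
theorem fastClassSqueeze_iff_planeFieldSqueeze :
    Summit.NavierStokesRegularity.NavierStokesRegularity.Theses.HodographBetchov.FastClassSqueeze ↔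
    (∀ (ν T : ℝ), 0 < ν → 0 < T →
      ∀ (u : ℝ → EuclideanSpace ℝ (Fin 3) → EuclideanSpace ℝ (Fin 3))
        (p : ℝ → EuclideanSpace ℝ (Fin 3) → ℝ),
        Literature.Analysis.FluidPDE.IsClassicalNSSolutionOn (Set.Ico 0 T) ν 0 u p →
        Literature.Analysis.FluidPDE.IsLerayHopfOn T ν 0 (u 0) u →
        Literature.Analysis.FluidPDE.HasRapidSpatialDecay (u 0) →
        ∃ n : ℝ → EuclideanSpace ℝ (Fin 3) → EuclideanSpace ℝ (Fin 3),
        ∃ l : ℝ, 0 < l ∧ ∃ q : ℝ, 3 / 2 < q ∧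
          ∫⁻ t in Set.Ioo 0 T, (∫⁻ x in {x : EuclideanSpace ℝ (Fin 3) | l < ‖u t x‖},
            ENNReal.ofReal (sSup ((fun ξ : EuclideanSpace ℝ (Fin 3) =>
              inner ℝ (fderiv ℝ (u t) x ξ) ξ) ''
                {ξ : EuclideanSpace ℝ (Fin 3) | inner ℝ ξ (n t x) = 0 ∧ ‖ξ‖ = 1})) ^ q) ^
              (2 / (2 * q - 3)) < ⊤) := by
  constructor
  · intro h ν T hν hT u p hcl hLH hdec
    obtain ⟨l, hl, q, hq, m, -, hclause, hint⟩ := h ν T hν hT u p hcl hLH hdec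
    -- at each fast point the clause's plane has a normal `n` with `τ(∇u, n) ≤ m`
    have key : ∀ t ∈ Set.Ico 0 T, ∀ x, l < ‖u t x‖ → ∃ n : EuclideanSpace ℝ (Fin 3),
        sSup ((fun ξ => ⟪fderiv ℝ (u t) x ξ, ξ⟫_ℝ) '' {ξ | ⟪ξ, n⟫_ℝ = 0 ∧ ‖ξ‖ = 1}) ≤
          m t x := by
      intro t ht x hx
      obtain ⟨v, w, hv, hw, hvw, hm⟩ := hclause t ht x hx
      obtain ⟨n, hvn, hn⟩ := exists_normal_of_orthonormal_pair hv hw hvw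
      exact ⟨n, transverseSup_le hv hw hvw hvn hn hm⟩
    classical
    refine ⟨fun t x => if h : t ∈ Set.Ico 0 T ∧ l < ‖u t x‖ then (key t h.1 x h.2).choose else 0,
      l, hl, q, hq, lt_of_le_of_lt ?_ hint⟩
    have hq0 : 0 ≤ q := by linarith
    have hr0 : 0 ≤ 2 / (2 * q - 3) := div_nonneg zero_le_two (by linarith)
    refine lintegral_mono_ae ?_
    filter_upwards [ae_restrict_mem measurableSet_Ioo] with t ht
    refine ENNReal.rpow_le_rpow ?_ hr0
    have hF : MeasurableSet {x : EuclideanSpace ℝ (Fin 3) | l < ‖u t x‖} :=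
      measurableSet_lt measurable_const
        (hcl.contDiff_velocity (Ioo_subset_Ico_self ht)).continuous.norm.measurable
    refine setLIntegral_mono' hF fun x hx => ?_
    refine ENNReal.rpow_le_rpow (ENNReal.ofReal_le_ofReal ?_) hq0
    have hdite : (if h : t ∈ Set.Ico 0 T ∧ l < ‖u t x‖ then (key t h.1 x h.2).choose
        else (0 : EuclideanSpace ℝ (Fin 3))) = (key t (Ioo_subset_Ico_self ht) x hx).choose :=
      dif_pos ⟨Ioo_subset_Ico_self ht, hx⟩
    rw [hdite]
    exact (key t (Ioo_subset_Ico_self ht) x hx).choose_spec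
  · intro h ν T hν hT u p hcl hLH hdec
    obtain ⟨n, l, hl, q, hq, hint⟩ := h ν T hν hT u p hcl hLH hdec
    refine ⟨l, hl, q, hq, fun t x => max 0 (sSup ((fun ξ => ⟪fderiv ℝ (u t) x ξ, ξ⟫_ℝ) ''
        {ξ | ⟪ξ, n t x⟫_ℝ = 0 ∧ ‖ξ‖ = 1})), fun t x => le_max_left _ _, ?_, ?_⟩
    · intro t _ x _
      obtain ⟨v, w, hv, hw, hvw, hvn, hwn⟩ := exists_orthonormal_pair_perp (n t x)
      refine ⟨v, w, hv, hw, hvw, fun α β => ?_⟩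
      refine (form_le_transverseSup_mul (fderiv ℝ (u t) x) (n t x) hv hw hvw hvn hwn α β).trans ?_
      exact mul_le_mul_of_nonneg_right (le_max_right _ _) (by positivity)
    · -- `ENNReal.ofReal` forgets the negative part: `ofReal (max 0 s) = ofReal s`
      have hmax : ∀ s : ℝ, ENNReal.ofReal (max 0 s) = ENNReal.ofReal s := fun s => by
        rcases le_total 0 s with h | h
        · rw [max_eq_right h]
        · rw [max_eq_left h, ENNReal.ofReal_of_nonpos h, ENNReal.ofReal_zero]
      simp_rw [hmax]
      exact hint

/-! ## The transfer lemmas of cards `stream-normal-block` and `velocity-adapted-planes` -/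

/-- **`FastClassSqueeze` from the STREAM-NORMAL squeeze** (card `stream-normal-block`, its
`StreamNormalSqueezeTransfer`; also plane `Π_U = u^⊥` of card `velocity-adapted-planes`): it suffices
that along every such solution, for some `l > 0`, `q > 3/2`, the top eigenvalue
`s_⊥(t,x) = sup {⟪∇u ξ, ξ⟫ : ξ ⊥ u(t,x), ‖ξ‖ = 1}` of the strain compressed to the plane normal to
the velocity is Miller-integrable on the fast class: `∫₀ᵀ (∫_{|u(t)|>l} (s_⊥⁺)^q)^{2/(2q−3)} < ∞`.
(The plane field `n = u`.) [cite: HornJohnson2013, Thm 4.2.6] -/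
theorem fastClassSqueeze_of_streamNormalSqueeze
    (h : ∀ (ν T : ℝ), 0 < ν → 0 < T →
      ∀ (u : ℝ → EuclideanSpace ℝ (Fin 3) → EuclideanSpace ℝ (Fin 3))
        (p : ℝ → EuclideanSpace ℝ (Fin 3) → ℝ),
        Literature.Analysis.FluidPDE.IsClassicalNSSolutionOn (Set.Ico 0 T) ν 0 u p →
        Literature.Analysis.FluidPDE.IsLerayHopfOn T ν 0 (u 0) u →
        Literature.Analysis.FluidPDE.HasRapidSpatialDecay (u 0) →
        ∃ l : ℝ, 0 < l ∧ ∃ q : ℝ, 3 / 2 < q ∧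
          ∫⁻ t in Set.Ioo 0 T, (∫⁻ x in {x : EuclideanSpace ℝ (Fin 3) | l < ‖u t x‖},
            ENNReal.ofReal (sSup ((fun ξ : EuclideanSpace ℝ (Fin 3) =>
              inner ℝ (fderiv ℝ (u t) x ξ) ξ) ''
                {ξ : EuclideanSpace ℝ (Fin 3) | inner ℝ ξ (u t x) = 0 ∧ ‖ξ‖ = 1})) ^ q) ^
              (2 / (2 * q - 3)) < ⊤) :
    Summit.NavierStokesRegularity.NavierStokesRegularity.Theses.HodographBetchov.FastClassSqueeze :=
  fastClassSqueeze_iff_planeFieldSqueeze.2 fun ν T hν hT u p hcl hLH hdec =>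
    ⟨u, h ν T hν hT u p hcl hLH hdec⟩

/-- **`FastClassSqueeze` from the ISOTACH squeeze** (card `velocity-adapted-planes`, plane
`Π_I = ((∇u)ᵀu)^⊥`, the tangent plane of the isotach `{|u| = const}`): it suffices that along every
such solution, for some `l > 0`, `q > 3/2`, the top eigenvalue of the strain compressed to the
isotach tangent plane is Miller-integrable on the fast class. (The plane field `n = (∇u)†u`; where
`(∇u)†u = 0` the supremum runs over the whole unit sphere, still a majorant.)
[cite: HornJohnson2013, Thm 4.2.6] -/
theorem fastClassSqueeze_of_isotachSqueeze
    (h : ∀ (ν T : ℝ), 0 < ν → 0 < T →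
      ∀ (u : ℝ → EuclideanSpace ℝ (Fin 3) → EuclideanSpace ℝ (Fin 3))
        (p : ℝ → EuclideanSpace ℝ (Fin 3) → ℝ),
        Literature.Analysis.FluidPDE.IsClassicalNSSolutionOn (Set.Ico 0 T) ν 0 u p →
        Literature.Analysis.FluidPDE.IsLerayHopfOn T ν 0 (u 0) u →
        Literature.Analysis.FluidPDE.HasRapidSpatialDecay (u 0) →
        ∃ l : ℝ, 0 < l ∧ ∃ q : ℝ, 3 / 2 < q ∧
          ∫⁻ t in Set.Ioo 0 T, (∫⁻ x in {x : EuclideanSpace ℝ (Fin 3) | l < ‖u t x‖},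
            ENNReal.ofReal (sSup ((fun ξ : EuclideanSpace ℝ (Fin 3) =>
              inner ℝ (fderiv ℝ (u t) x ξ) ξ) ''
                {ξ : EuclideanSpace ℝ (Fin 3) |
                  inner ℝ ξ (ContinuousLinearMap.adjoint (fderiv ℝ (u t) x) (u t x)) = 0 ∧
                  ‖ξ‖ = 1})) ^ q) ^ (2 / (2 * q - 3)) < ⊤) :
    Summit.NavierStokesRegularity.NavierStokesRegularity.Theses.HodographBetchov.FastClassSqueeze :=
  fastClassSqueeze_iff_planeFieldSqueeze.2 fun ν T hν hT u p hcl hLH hdec =>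
    ⟨fun t x => ContinuousLinearMap.adjoint (fderiv ℝ (u t) x) (u t x), h ν T hν hT u p hcl hLH hdec⟩

/-- **`FastClassSqueeze` from the MENU squeeze** (card `velocity-adapted-planes`, its
`menu_admissible` / `fastClassSqueeze_of_adaptedPlaneSqueeze`): with `τ_U`, `τ_I` the top eigenvalues
of the strain compressed to the stream-normal plane `u^⊥` and to the isotach tangent plane
`((∇u)ᵀu)^⊥`, it suffices that `min(τ_U, τ_I)⁺` is Miller-integrable on the fast class — the plane
field switches pointwise to whichever plane is tighter. [cite: HornJohnson2013, Thm 4.2.6] -/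
theorem fastClassSqueeze_of_menuSqueeze
    (h : ∀ (ν T : ℝ), 0 < ν → 0 < T →
      ∀ (u : ℝ → EuclideanSpace ℝ (Fin 3) → EuclideanSpace ℝ (Fin 3))
        (p : ℝ → EuclideanSpace ℝ (Fin 3) → ℝ),
        Literature.Analysis.FluidPDE.IsClassicalNSSolutionOn (Set.Ico 0 T) ν 0 u p →
        Literature.Analysis.FluidPDE.IsLerayHopfOn T ν 0 (u 0) u →
        Literature.Analysis.FluidPDE.HasRapidSpatialDecay (u 0) →
        ∃ l : ℝ, 0 < l ∧ ∃ q : ℝ, 3 / 2 < q ∧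
          ∫⁻ t in Set.Ioo 0 T, (∫⁻ x in {x : EuclideanSpace ℝ (Fin 3) | l < ‖u t x‖},
            ENNReal.ofReal (min
              (sSup ((fun ξ : EuclideanSpace ℝ (Fin 3) => inner ℝ (fderiv ℝ (u t) x ξ) ξ) ''
                {ξ : EuclideanSpace ℝ (Fin 3) | inner ℝ ξ (u t x) = 0 ∧ ‖ξ‖ = 1}))
              (sSup ((fun ξ : EuclideanSpace ℝ (Fin 3) => inner ℝ (fderiv ℝ (u t) x ξ) ξ) ''
                {ξ : EuclideanSpace ℝ (Fin 3) |
                  inner ℝ ξ (ContinuousLinearMap.adjoint (fderiv ℝ (u t) x) (u t x)) = 0 ∧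
                  ‖ξ‖ = 1}))) ^ q) ^ (2 / (2 * q - 3)) < ⊤) :
    Summit.NavierStokesRegularity.NavierStokesRegularity.Theses.HodographBetchov.FastClassSqueeze := by
  classical
  refine fastClassSqueeze_iff_planeFieldSqueeze.2 fun ν T hν hT u p hcl hLH hdec => ?_
  obtain ⟨l, hl, q, hq, hint⟩ := h ν T hν hT u p hcl hLH hdec
  -- the switching plane field
  set τU : ℝ → EuclideanSpace ℝ (Fin 3) → ℝ := fun t x =>
    sSup ((fun ξ => ⟪fderiv ℝ (u t) x ξ, ξ⟫_ℝ) '' {ξ | ⟪ξ, u t x⟫_ℝ = 0 ∧ ‖ξ‖ = 1}) with hτU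
  set τI : ℝ → EuclideanSpace ℝ (Fin 3) → ℝ := fun t x =>
    sSup ((fun ξ => ⟪fderiv ℝ (u t) x ξ, ξ⟫_ℝ) ''
      {ξ | ⟪ξ, ContinuousLinearMap.adjoint (fderiv ℝ (u t) x) (u t x)⟫_ℝ = 0 ∧ ‖ξ‖ = 1}) with hτI
  refine ⟨fun t x => if τU t x ≤ τI t x then u t x
      else ContinuousLinearMap.adjoint (fderiv ℝ (u t) x) (u t x), l, hl, q, hq, ?_⟩
  refine lt_of_le_of_lt (le_of_eq ?_) hint
  refine lintegral_congr fun t => ?_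
  congr 1
  refine lintegral_congr fun x => ?_
  congr 2
  beta_reduce
  by_cases hle : τU t x ≤ τI t x
  · rw [if_pos hle, min_eq_left hle]
  · rw [if_neg hle, min_eq_right (le_of_lt (not_le.1 hle))]

end Summit.NavierStokesRegularity.NavierStokesRegularity.Theorems.FastClassSqueeze.PlaneField

end
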